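import Summits.HodgeConjecture.HodgeConjecture.Theorems.F0P2oThetaInPSOfLetters            -- ★ p828142 B-p18 (g28): K1 `stubThetaInPS_of_letters (hN3) (hW) (hU1)` (+ the N3∕K1w∕U1 letter modules, ★ `F0P2oK1occ` GLUE-O)
import Summits.HodgeConjecture.HodgeConjecture.Theorems.F0P2oStubDictTorusChar              -- ★ p826011 F0P2-p02 (g5): K2 `stubDictTorusChar_holds`
import Summits.HodgeConjecture.HodgeConjecture.Theorems.F0P2oGR90Prop522OfLetters           -- ★ p829082 B-p14 (g27): SC `GR90Prop522_of_letters (hN3) (hN6)` (+ the N4∕N6 letter modules)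
import Summits.HodgeConjecture.HodgeConjecture.Theorems.F0P2oThetaCenterCharIndep           -- ★ p828537 F0P2-p02 (g6): GLUE-I `stubThetaCenterCharIndep_holds`
import Summits.HodgeConjecture.HodgeConjecture.Theorems.F0P2oThetaClassOfSupercuspidal      -- ★ p828652 F0P2-p02 (g6): CLS `stubThetaClassOfSupercuspidal_holds`
import Summits.HodgeConjecture.HodgeConjecture.Theorems.F0P2oSupercuspidalNeConstituent     -- ★ p828800 F0P2-p02 (g6): NE `stubSupercuspidalNeConstituent_of_N6 (hN6)`
import Literature.NumberTheory.GelbartRogawski1991.XiLocalPacketNonsplitThetaPair          -- ★ p826161 typ-T7b (g0): THE TARGET LETTER #75-loc `xiLocalPacket_nonsplit_isThetaPair` (BY NAME)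
import Literature.NumberTheory.GelbartRogawski1991.U1ThetaDichotomy                        -- ★ p826953 ∕ p827180 typ-T7b (g0): the U1 letter + `u1Occurrence_exists_not`
import HarnessLib

/-!
# Crux `H413`, programme P2 — ROW «T7-TWIN»: THE LOCAL THETA DICHOTOMY FOR THE TRUE PACKET `{πⁿ(ξ_v), πˢ(ξ_v)}` AT A NON-SPLIT PLACE
# [GelbartRogawski1991 Lem. 5.1.2, §1.4; GelbartRogawski1990 Prop. 5.2.2] — the booked letter #75-loc ★ `xiLocalPacket_nonsplit_isThetaPair` FROM FIVE PRINT LETTERS,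
# composed Lines-free over the seven ★ `Theorems/F0P2o*` closers (`xiLocalPacket_nonsplit_isThetaPair_of_letters`)

Cell hodgecm-mathlib (D-0151), FLOOR 0, crux item H413 = stmt-HodgeConjecture-24833, route of record `HCCMUnconditional`; programme P2, topic T7; desk F0P2-plan (g8)
row «T7-TWIN» (2026-08-31): the Lines-free THEOREMS TWIN of seat typ-T7b's draft line `F0/P2/Lines-draft/T7b_LocalThetaDichotomy.lean` v1.5 (45ffc19ed8961bbb) §3–§4
(`stubNonOccurringClass_of_letters`, `k1plus_of_K1_label`, `k3_of_letters`, `d7alphaLocal_of_stubs`, `d7alphaLocalTarget_iff_letter`), with EVERY layer-B stub replaced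
by its ★ `Theorems/` closer BY NAME and the composition INLINED as one `obtain` chain (THEOREMS ONLY — no definition, so the draft's intermediate Props K1⁺ ∕ K3 ∕ OCC are
not re-declared; no `Cruxes/…/Lines` import, O50-1).  TARGET BY NAME: ★ `GelbartRogawski1991.xiLocalPacket_nonsplit_isThetaPair` (p826161; = the draft's
`D7alphaLocalTarget` token for token).  HC_CM is proved only modulo the printed citations until rung 0 closes; this file proves no letter — it composes.

THE HEAD `xiLocalPacket_nonsplit_isThetaPair_of_letters (hN3) (hW) (hU1) (hN6) (hL)` is CONDITIONAL on exactly FIVE inputs, taken as hypotheses BY NAME ∕ BY TEXT: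
* `hN3 : GelbartRogawski1991.thetaType_nonsplit_jacquetModule` [GelbartRogawski1991 §3.2 (3.2.1)–(3.2.3) p. 457; Kudla1986 Thm. 2.8] (★ letter p826177);
* `hW : Rogawski1990.cmPrincipalSeries_isConstituentOf_weylConj` [Rogawski1990 §12.2 p. 174 L3–5; BernsteinZelevinsky1977 Thm. 2.9] (★ letter p826332);
* `hU1 : GelbartRogawski1991.u1ThetaDichotomy_nonsplit` [HarrisKudlaSweet1996 Cor. 4.4; Rogawski1992 Prop. 3.4] (★ letter p826953 ∕ p827180);
* `hN6 : Rogawski1990.u3_isSupercuspidal_iff_jacquet_eq_zero` [GetzHahn2024 Thm. 8.3.3; Rogawski1990 §12.2 p. 173] (★ letter p826085);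
* `hL` : the LABEL «the theta type of an OCCURRING class is not square-integrable modulo the centre» — the draft's `StubThetaTypeNotL2` body (v1.5 :225–246) VERBATIM
  with the Lines-local `CenterCharSpec` spelled by its token-identical ★ twin `IsThetaCenterChar`; = the conclusion type of B-p18 (g28)'s `Theorems/F0P2oThetaTypeNotL2.lean ::
  thetaType_not_squareIntegrable (hN3) (hN7)` [Rogawski1990 §12.2 (2) p. 174; Casselman1995 Thm. 4.4.6], so the T7 line feeds `hL := thetaType_not_squareIntegrable stub_N3 stub_N7`.
THE ★ CLOSERS CONSUMED BY NAME: K1 `F0P2oThetaInPSOfLetters.stubThetaInPS_of_letters hN3 hW hU1` (B-p18 (g28)); K2 `F0P2oStubDictTorusChar.stubDictTorusChar_holds` (F0P2-p02 (g5));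
SC `F0P2oGR90Prop522OfLetters.GR90Prop522_of_letters hN3 hN6` (B-p14 (g27)); GLUE-I `F0P2oThetaCenterCharIndep.stubThetaCenterCharIndep_holds`, CLS
`F0P2oThetaClassOfSupercuspidal.stubThetaClassOfSupercuspidal_holds`, NE `F0P2oSupercuspidalNeConstituent.stubSupercuspidalNeConstituent_of_N6 hN6` (F0P2-p02 (g6)); OCC =
★ `u1Occurrence_exists_not hU1` at the Witt kernel line `kernelLineCM dV` + GLUE-O ★ `F0P2oK1occ.continuous_of_isThetaCenterChar` (F0P2-p01).

## Proof (the draft's §3, inlined)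
Given the letter's data at a non-split `v` with a form congruence `ᵗT̄ H_v T = a Φ₃`: K1 gives `(ε, x₀, ψθ)` with `IsThetaCenterChar`, `x₀` a constituent of `i_G(χθ)`,
`χθ = cmXiTorusChar L v μ_v ψθ⁻¹ ψθ`, and the theta-type clause at `ε` (= `εn`); the LABEL `hL` makes `x₀` non-square-integrable mod centre; OCC (U1 letter + GLUE-O continuity)
gives a line class `ε′` at which `ψθ` does NOT occur, GLUE-I moves `IsThetaCenterChar` to `ε′`, SC (GR90 Prop. 5.2.2) makes `X_v(μ, ε′, χ_f)` supercuspidal, CLS produces its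
supercuspidal class `πs` on `U(H)(L⁺_v)` with the theta-type clause at `ε′` (= `εs`), NE separates `πs` from the transport of the principal-series constituent `x₀`; finally K2
rewrites `χ_ξ = cmXiTorusChar L v μω_v η_v ψ_v` into `χθ` — `ξ` eliminates.

## References
- [GelbartRogawski1991] S. Gelbart, J. Rogawski, *L-functions and Fourier–Jacobi coefficients for the unitary group U(3)*, Invent. Math. 105 (1991) — §1.4 pp. 450–451; §3.2 p. 457; §5.1 (5.1.1), Lem. 5.1.2 pp. 465–466; Remark p. 466; Cor. 5.2.2 p. 467.
- [GelbartRogawski1990] S. Gelbart, J. Rogawski, *Exceptional representations and Shimura's integral for the local unitary group U(3)* (1990) — Prop. 5.2.2.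
- [Rogawski1990] J. Rogawski, *Automorphic Representations of Unitary Groups in Three Variables*, Ann. of Math. Stud. 123 — §12.1 p. 172; §12.2 pp. 173–174; §13.1 p. 199.
- [Kudla1986] S. Kudla, *On the local theta-correspondence*, Invent. Math. 83 (1986) — Thm. 2.8.
- [HarrisKudlaSweet1996] M. Harris, S. Kudla, W. J. Sweet, *Theta dichotomy for unitary groups*, JAMS 9 (1996) — Cor. 4.4.
- [Casselman1995] W. Casselman, *Introduction to the theory of admissible representations of p-adic reductive groups* — Thm. 4.4.6, Thm. 5.3.1.
-/

set_option autoImplicit false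
-- the mandated namespace has the single-problem summit's repeated segment (`HodgeConjecture.HodgeConjecture`)
set_option linter.dupNamespace false

noncomputable section

open NumberField IsDedekindDomain MeasureTheory
open scoped Matrix

open Literature.NumberTheory Literature.NumberTheory.Automorphic Literature.NumberTheory.Automorphic.UnitaryGroup
open Literature.NumberTheory.Automorphic.IdeleClassGroup
open Literature.NumberTheory.Automorphic.Liu2021 Literature.NumberTheory.Automorphic.Liu2021.Def411WeilCarriers
open Literature.NumberTheory.GaloisRepresentations
open Literature.NumberTheory.Rogawski1990
open Literature.NumberTheory.GelbartRogawski1991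

namespace Summit.HodgeConjecture.HodgeConjecture.Cruxes.H413.F0P2oXiLocalPacketThetaPairOfLetters

set_option synthInstance.maxHeartbeats 400000 in
set_option maxHeartbeats 16000000 in
/-- **THE LOCAL THETA DICHOTOMY FOR THE TRUE PACKET AT A NON-SPLIT PLACE, FROM THE PRINT LETTERS N3, K1w, U1, N6 AND THE LABEL** — the booked letter #75-loc
★ `GelbartRogawski1991.xiLocalPacket_nonsplit_isThetaPair` BY NAME: for the CM frame, `ξ = (η, ψ)`, `μω`, the dictionary pair `(μ, χ_f)`, a NON-SPLIT finite place `v`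
and a form congruence, (n) some NON-square-integrable Jordan–Hölder constituent `x₀` of `i_G(χ_ξ)` transports to the theta type `X_v(μ, εn, χ_f) ∘ κ_v⁻¹`, and (s) some
SUPERCUSPIDAL class `πs ≠ x₀ ∘ e` of `U(H)(L⁺_v)` is the theta type `X_v(μ, εs, χ_f) ∘ κ_v⁻¹`.  Proof = typ-T7b's draft §3 (`d7alphaLocal_of_stubs` ∘ `k1plus_of_K1_label` ∘
`k3_of_letters` ∘ `stubNonOccurringClass_of_letters`) inlined over the seven ★ closers (module docstring).  `hL` = the draft's `StubThetaTypeNotL2` body VERBATIM with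
`CenterCharSpec` ↦ ★ `IsThetaCenterChar` (B-p18 (g28)'s `thetaType_not_squareIntegrable (hN3) (hN7)` supplies it).
[cite: GelbartRogawski1991, Lem. 5.1.2 p. 466; §1.4 pp. 450–451; §5.1 (5.1.1) p. 465; Remark p. 466; Cor. 5.2.2 p. 467] [cite: GelbartRogawski1990, Prop. 5.2.2]
[cite: Rogawski1990, §12.2 (2) p. 174; §12.2 p. 173] [cite: Kudla1986, Thm. 2.8] [cite: HarrisKudlaSweet1996, Cor. 4.4] [cite: Casselman1995, Thm. 4.4.6] -/
theorem xiLocalPacket_nonsplit_isThetaPair_of_letters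
    (hN3 : Literature.NumberTheory.GelbartRogawski1991.thetaType_nonsplit_jacquetModule)
    (hW : Literature.NumberTheory.Rogawski1990.cmPrincipalSeries_isConstituentOf_weylConj)
    (hU1 : Literature.NumberTheory.GelbartRogawski1991.u1ThetaDichotomy_nonsplit)
    (hN6 : Literature.NumberTheory.Rogawski1990.u3_isSupercuspidal_iff_jacquet_eq_zero)
    (hL :
      ∀ (L : Type) [Field L] [NumberField L] [IsCMField L] (H : Matrix (Fin 3) (Fin 3) L) (hH : (H.map (cmConjRingHom L))ᵀ = H) (hHd : IsUnit H.det)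
        {n' : ℕ} (e₁ : Fin 3 × Fin 1 ≃ Fin n') (dV : Fin 3 → L) (hdV : ∀ i, IsCMField.complexConj L (dV i) = dV i) (hdV0 : ∀ i, dV i ≠ 0) (g : GL (Fin 3) L)
        (hg : ((g : Matrix (Fin 3) (Fin 3) L).map (cmConjRingHom L))ᵀ * H * (g : Matrix (Fin 3) (Fin 3) L) = Matrix.diagonal dV),
        ∀ (μ : Literature.NumberTheory.Automorphic.IdeleClassGroup L →ₜ* Circle) (hμ : IsConjugateSymplectic L μ)
          (χf : UnitaryGroup.finAdelicOne (↥(maximalRealSubfield L)) L (IsCMField.complexConj L) →* ℂˣ),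
          Continuous χf → (∀ z, ‖((χf z : ℂˣ) : ℂ)‖ = 1) →
          ∀ (v : HeightOneSpectrum (𝓞 ↥(maximalRealSubfield L))),
            (∀ w : PlacesOver L v, IsCMField.complexConj L • w.1 = w.1) →
            ∀ (T : GL (Fin 3) (UnitaryGroup.LocalRing L v)) (a : UnitaryGroup.LocalRing L v) (ha : IsUnit a)
              (h : formCongr (conjLocal L (IsCMField.complexConj L) v) T (H.map (algebraMap L (UnitaryGroup.LocalRing L v))) =
                a • (Matrix.of fun i j : Fin 3 => if i.val + j.val + 1 = 3 then (1 : L) else 0).map (algebraMap L (UnitaryGroup.LocalRing L v)))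
              (ε : (↥(maximalRealSubfield L))ˣ) (x₀ : IrrClass (Gqs L v)) (ψθ : ↥(normOneUnits (conjLocal L (IsCMField.complexConj L) v)) →* ℂˣ),
              IsThetaCenterChar L μ χf ε v ψθ →
              x₀.IsConstituentOf (cmPrincipalSeries L 3 v (cmXiTorusChar L v ((toHeckeCharacter L μ).semilocalComponent L v) ψθ⁻¹ ψθ)) →
              ThetaTypeAtCM L H e₁ dV hdV hdV0 g hg μ hμ χf ε v (IrrClass.comap (cmDatumLocalCongr L v T ha h).symm x₀) →
              ∀ [MeasurableSpace (Gqs L v ⧸ Subgroup.center (Gqs L v))] [BorelSpace (Gqs L v ⧸ Subgroup.center (Gqs L v))]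
                (μZ : Measure (Gqs L v ⧸ Subgroup.center (Gqs L v))) [μZ.IsHaarMeasure], ¬ x₀.IsSquareIntegrable μZ) :
    Literature.NumberTheory.GelbartRogawski1991.xiLocalPacket_nonsplit_isThetaPair := by
  intro L _ _ _ H hH hHd n' e₁ dV hdV hdV0 g hg ξ μω hμu hquad μ hμ χf hcont hunit hdμ hdχ v hv T a ha h
  -- K1 (#76's local theta statement, from N3 + K1w + U1): the occurring class `ε`, the constituent `x₀`, the centre character `ψθ`
  obtain ⟨ε, x₀, ψθ, hspec, hconst, hθ⟩ :=
    F0P2oThetaInPSOfLetters.stubThetaInPS_of_letters hN3 hW hU1 L H hH hHd e₁ dV hdV hdV0 g hg μ hμ χf hcont hunit v hv T a ha h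
  -- OCC (U1 letter at the Witt kernel line; `ψθ` continuous by GLUE-O): a NON-occurring line class `ε'`
  obtain ⟨ε', hnocc⟩ :=
    u1Occurrence_exists_not hU1 L ((finProdFinEquiv : Fin 1 × Fin 1 ≃ Fin (1 * 1))) (kernelLineCM dV) (complexConj_kernelLineCM dV hdV)
      (kernelLineCM_ne_zero dV hdV0) μ hμ v hv ψθ (F0P2oK1occ.continuous_of_isThetaCenterChar L μ χf hcont ε v ψθ hspec)
  -- GLUE-I: the centre-character constraint does not see the line
  have hspecε' : IsThetaCenterChar L μ χf ε' v ψθ :=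
    F0P2oThetaCenterCharIndep.stubThetaCenterCharIndep_holds L μ χf ε ε' v ψθ hspec
  -- SC (GR90 Prop. 5.2.2 from N3 + N6): the theta type at the non-occurring class is supercuspidal
  have hsc : (xThetaCM L e₁ dV hdV hdV0 μ hμ χf ε' v).IsSupercuspidal :=
    (F0P2oGR90Prop522OfLetters.GR90Prop522_of_letters hN3 hN6 L e₁ dV hdV hdV0 ((finProdFinEquiv : Fin 1 × Fin 1 ≃ Fin (1 * 1)))
      μ hμ χf hcont hunit v hv ε' ψθ hspecε').2 hnocc
  -- CLS: its supercuspidal class on `U(H)(L⁺_v)` with the theta-type clause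
  obtain ⟨πs, hπs, hθ'⟩ :=
    F0P2oThetaClassOfSupercuspidal.stubThetaClassOfSupercuspidal_holds L H hH hHd e₁ dV hdV hdV0 g hg μ hμ χf hcont hunit v hv ε' hsc
  -- NE: a supercuspidal class is not the transport of a principal-series constituent
  have hne : πs ≠ IrrClass.comap (cmDatumLocalCongr L v T ha h).symm x₀ :=
    F0P2oSupercuspidalNeConstituent.stubSupercuspidalNeConstituent_of_N6 hN6 L H v hv T a ha h _ x₀ hconst πs hπs
  -- assemble (n) and (s); the LABEL gives non-square-integrability of `x₀`; K2 eliminates `ξ` from the inducing character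
  refine ⟨ε, ε', x₀, πs, ?_, ?_, hθ, hπs, hne, hθ'⟩
  · rw [F0P2oStubDictTorusChar.stubDictTorusChar_holds L ξ μω hμu hquad μ hμ χf hcont hunit hdμ hdχ v hv ε ψθ hspec]
    exact hconst
  · intro _ _ μZ _
    exact hL L H hH hHd e₁ dV hdV hdV0 g hg μ hμ χf hcont hunit v hv T a ha h ε x₀ ψθ hspec hconst hθ μZ

end Summit.HodgeConjecture.HodgeConjecture.Cruxes.H413.F0P2oXiLocalPacketThetaPairOfLetters

end
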